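import Literature.NumberTheory.GaloisRepresentations.LocalGlobalCohomology
import HarnessLib

/-!
# Barrier (BirchSwinnertonDyer): local-condition refinements of Kolyvagin's method see the MAXIMUM of the Tamagawa exponents, never their SUM («stringency caps at max»)

Barrier catalogue `Literature/Barriers/BirchSwinnertonDyer/` (D-0021), entry for the technique class
**refining an Euler-system or Kolyvagin-system argument by STRICTER LOCAL CONDITIONS at the places of bad reduction**
(Jetchev 2008, the «stringent Kummer structures» `𝓕_⌈q₁…q_s⌉` for Heegner points; Büyükboduk 2009, the
structure `𝓕_{u-ℓ}` «unramified at `ℓ`» for Kato's Euler system; every «multi-prime stringent» variant), aimed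
at the Tamagawa factors of the Birch–Swinnerton-Dyer / Bloch–Kato formula. Suggested by the W-ALL width seat
`bsd-wall-soed-p2-w3` g0 (method census `Summits/BirchSwinnertonDyer/BirchSwinnertonDyer/Cruxes/WildKolyvaginUpperAtThree/NOGO-STRINGENT-SCALING-w3.md`,
2026-08-27, on SOED's crux Ko `WildKolyvaginUpperAtThree` / J `WildSigmaDivisibilityAtThree` at the additive
prime `3`); filed by the same seat. HONEST FRAMING: the Lean statement is an ELEMENTARY THEOREM about Selmer
groups of a discrete Galois module (`stringentKolyvaginCapsAtMax_holds`, five lines over the tree's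
`SelmerStructure.selmerGroup`); the barrier is the READING of that theorem against the printed method (docstring
keys `because` / `blocks`). It does NOT say that the Σ-form of the refined Kolyvagin identity is false or
unprovable — only that it is not a consequence of local conditions at the bad places (scope_caveats).

## The wall, as printed (texts held in the literature store; arXiv pages)

* Jetchev, Compositio Math. 144 (2008) 811–826 = arXiv:math/0703431. The predicted identity (1.3) (p. 3): «`m_∞ = ord_p(∏_{q∣N} c_q)`»;
  Thm. 1.4: «If `m_max = max_{q∣N} ord_p(c_q)`, then `m_∞ ≥ m_max`»; Cor. 1.5: «In particular, if `p` divides at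
  most one Tamagawa number, the above upper bound coincides with the exact upper bound … predicted by the Birch
  and Swinnerton-Dyer […] formula». Def. 4.8 (p. 13) DEFINES the multi-prime stringent structure
  `𝓕_⌈q₁…q_s⌉` (local condition `H¹_{Kum⁰}(K_v,E[p^m]) = δ_v(E⁰(K_v))` at every `v ∣ q_i`) and Prop. 4.9 proves
  the Heegner classes lie in `H¹_{𝓕_⌈q₁…q_s⌉(c)}` for ALL `s` at once; but the proof of Thm. 1.4 (Thm. 6.3, p. 15)
  uses ONE prime: «Consider the stringent Kummer Selmer structure `𝓕₀ := 𝓕_⌈q⌉` which differs from `𝓕` only at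
  the two places `v` and `v̄` above `q` for which `ord_p(c_q) = m_max`», with the footnote «the exact sequence
  implies `m − m′ ≤ m_max`» — the ε-side sandwich of `because:` below.
* Büyükboduk, J. Number Theory 129 (2009) 402–417 = arXiv:0710.3858. Thm. A/B (p. 1–2): «Suppose `πⁿ` divides a
  Tamagawa number … the image of the Euler system to Kolyvagin system map is contained in `𝔪ⁿ KS(T)`»,
  `κ^{Kato} ∈ pⁿ KS(T)`; p. 2: «As one may notice, the "improvement" we give above includes only one Tamagawa
  factor. A further improvement which shall include all Tamagawa factors unfortunately escapes our method.»;
  mechanism Cor. 2.8 + Thm. 3.1 (pp. 10–11): on `T/𝔪ⁿT` with `n ≤ ord_p c_ℓ` the structure `𝓕_{u-ℓ}` has core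
  Selmer rank `0`, so `KS(T/𝔪ⁿT, 𝓕_{u-ℓ}, 𝓟_n) = 0`; §4.2 (p. 12) Questions 1–2: «Is it true that
  `κ^{Kato} ∈ ∏_{ℓ∣N} c_ℓ · KS(T, 𝓕_can, 𝓟)`?» / «`∈ p^d KS`», `d` = number of `ℓ` with `p ∣ c_ℓ` — unanswered in print, with
  level lowering suggested as the way out (i.e. OUTSIDE the technique class).
* Mazur–Rubin, Mem. AMS 799 (2004), Remark 6.2.5 / Prop. 6.2.6 (cite only): the Kolyvagin system of an Euler
  system is not expected to be primitive when `p` divides a Tamagawa number at `ℓ ≠ p`.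

## The theorem behind the wall (this file) and how it caps the method

For Selmer structures `𝓕 ≤ 𝓖` on a discrete Galois module over a number field `K` with `n_v • 𝓖_v ≤ 𝓕_v` at
every place `v` (`IsBoundedRefinementBy 𝓕 𝓖 n`; e.g. `𝓖` = Kummer, `𝓕` = stringent at a set `S` of Tamagawa
primes, `n_v = p^{ord_p c_v}` on `S`, `n_v = 1` off `S`, since `Kum_v/Kum⁰_v ≅ Φ_v ⊗ ℤ/p^m`) and ANY common
multiple `N` of the `n_v` — for prime powers, `N = p^{max_v ord_p c_v}` — one has `N • H¹_𝓖(K,M) ≤ H¹_𝓕(K,M)`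
(`stringentKolyvaginCapsAtMax_holds`). Consequently (memo §§2–3; ½ page on paper, not formalised here): for
every family of classes `κ` satisfying the Kolyvagin-system relations for `𝓖`, the family `N·κ` satisfies them
AND the refined local conditions `𝓕`, with its divisibility invariant `m_∞` shifted by exactly `ord_p N = max`;
so any derivation «relations + 𝓕-membership ⟹ m_∞ ≥ max + x» is a derivation «relations ⟹ m_∞ ≥ x» in which
the bad places do not occur. The exponent of a direct sum is the MAX of the exponents; its length is the SUM;
membership statements see exponents, the BSD formula needs the length. With the module of Kolyvagin systems
free of rank one (Mazur–Rubin Thm. 5.2.10, `p > 4`; Howard 2004 over `K`, `p ∤ N·d_K`) this reads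
`KS(𝓕_S) = p^{max}·KS(𝓕)` exactly (⊇ here; ⊆ Büyükboduk Cor. 2.8 / Jetchev Thm. 6.3).

## What survives (so the wall is NOT «the Σ-form is out of reach»)

* Iwasawa-main-identity (IMC) inputs: Burungale–Castella–Grossi–Skinner (arXiv:2312.09301) Thm. 2 proves
  `𝓜_∞ = Σ_ℓ ord_p c_ℓ` at good ordinary `p > 3` through the anticyclotomic IMC + a twisted CONTROL theorem whose
  error term has LENGTH `Σ_v ord_p c_v` (C.-H. Kim, arXiv:2203.12161, Cor. 7.8 proof) — lengths, not exponents.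
* Changing the datum: for Heegner points on Shimura curves `X_{N⁺,N⁻}` only the `N⁺`-Tamagawa numbers obstruct
  primitivity (Kim 2022 Cor. 7.8 (3); W. Zhang 2014) — carriers moved into `N⁻` leave the class.
* Congruences / level lowering at the Tamagawa primes (Büyükboduk §4.2's suggestion; Ribet): outside the class;
  no printed result beyond one prime.

## D-0021 structured block
Carried by the docstring of `StringentKolyvaginCapsAtMax` below (the catalogue parses DECLARATION docstrings).

## References (bib keys of `lean/references.bib`)
[Jetchev2008] (1.3), Thm. 1.4, Cor. 1.5 (arXiv p. 3), Def. 4.8, Prop. 4.9 (arXiv p. 13), Thm. 6.3 with footnote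
(arXiv p. 15) · [Buyukboduk2009TamagawaDefect] Thm. A/B (arXiv pp. 1–2), Cor. 2.8, Thm. 3.1, Cor. 3.3 (pp. 10–11),
§4.2 Questions 1–2 (p. 12) · [MazurRubinMemoirs2004] Remark 6.2.5, Prop. 6.2.6, Thm. 5.2.10 (cite only) ·
[Howard2004HeegnerKolyvagin] Thm. 1 hypotheses (arXiv:1202.6340 p. 3) · cell document: the memo named above
(evidence #10 on stmt-BirchSwinnertonDyer-20480, #7 on stmt-BirchSwinnertonDyer-20760).
-/

namespace Literature.Barriers.BirchSwinnertonDyer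

open Literature.NumberTheory.GaloisRepresentations Literature.NumberTheory.GaloisRepresentations.DiscreteGaloisModule
  NumberField

universe u

variable {K : Type u} [Field K] [NumberField K] {M : Type u} [AddCommGroup M] [TopologicalSpace M]
  [DiscreteTopology M]

/-- The technique class of this entry, as a predicate on a pair of Selmer structures: `𝓕` is a REFINEMENT of `𝓖`
BY BOUNDED MULTIPLIERS `n = (n_v)_v` if `n_v • x ∈ 𝓕_v` for every `x ∈ 𝓖_v`, at every place `v` — the shape of
every «stricter local condition at the bad places» in print: Jetchev's stringent Kummer condition
`δ_v(E⁰(K_v)) ≤ δ_v(E(K_v))` (multiplier `p^{ord_p c_v}`, the exponent of `Φ_v ⊗ ℤ_p`), Büyükboduk's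
`H¹_unr(ℚ_ℓ,T) ≤ H¹_f(ℚ_ℓ,T)` (index = the `p`-part of `c_ℓ`), and `n_v = 1` wherever `𝓕_v = 𝓖_v`.
[cite: Jetchev2008, Def. 4.8 (arXiv:math/0703431 p. 13)] [cite: Buyukboduk2009TamagawaDefect, §3 Remark 2 (arXiv:0710.3858 p. 10)] -/
def IsBoundedRefinementBy {ρ : DiscreteGaloisModule K M} (𝓕 𝓖 : SelmerStructure ρ) (n : Place K → ℕ) :
    Prop :=
  ∀ (v : Place K), ∀ x ∈ 𝓖 v, n v • x ∈ 𝓕 v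

/-- Unfolding of `IsBoundedRefinementBy`. [cite: Jetchev2008, Def. 4.8 (arXiv:math/0703431 p. 13)] -/
theorem isBoundedRefinementBy_iff {ρ : DiscreteGaloisModule K M} (𝓕 𝓖 : SelmerStructure ρ)
    (n : Place K → ℕ) : IsBoundedRefinementBy 𝓕 𝓖 n ↔ ∀ (v : Place K), ∀ x ∈ 𝓖 v, n v • x ∈ 𝓕 v :=
  Iff.rfl

/-- **The barrier**: for every number field `K`, every discrete Galois module `M`, every pair of Selmer
structures `𝓕, 𝓖` with `𝓕` a refinement of `𝓖` by bounded multipliers `(n_v)_v`, and every common multiple `N`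
of the `n_v` (for prime powers `n_v = p^{e_v}`: `N = p^{max_v e_v}`), `N • H¹_𝓖(K,M) ≤ H¹_𝓕(K,M)` — every
`𝓖`-Selmer class multiplied by `N` is an `𝓕`-Selmer class. PROVED below (`stringentKolyvaginCapsAtMax_holds`);
the closed `Prop` is the decl that idea cards and route theses cite.

BARRIER (D-0021), one line per key:
* technique_class: euler-systems kolyvagin-systems stringent-local-conditions tamagawa-defect — formally `IsBoundedRefinementBy 𝓕 𝓖 n` (a Selmer structure refined at finitely many bad places by local conditions of finite exponent) used as the ONLY extra input on top of the Kolyvagin-system relations, to extract the Tamagawa factors `∏_{q} c_q` of a BSD/Bloch–Kato formula from an Euler system (Heegner points: Jetchev's `𝓕_⌈q₁…q_s⌉`; Kato: Büyükboduk's `𝓕_{u-ℓ}`) [cite: Jetchev2008, Def. 4.8 and Prop. 4.9 (arXiv:math/0703431 p. 13)] [cite: Buyukboduk2009TamagawaDefect, Thm. 3.1 and Cor. 3.3 (arXiv:0710.3858 pp. 10–11)]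
* blocks: every attempt to prove the SUM form of a Tamagawa divisibility — Jetchev's predicted identity (1.3) «`m_∞ = ord_p ∏_q c_q`» (≥ half) beyond his Thm. 1.4 «`m_∞ ≥ max_q ord_p c_q`», Büyükboduk's §4.2 Questions 1–2 «`κ^{Kato} ∈ ∏ c_ℓ · KS(T)`», W. Zhang's / BCGS's refined Kolyvagin identity `𝓜_∞ = Σ ord_p c_ℓ` — from {Kolyvagin-system relations, Čebotarev, Poitou–Tate duality for Selmer structures, membership of the classes in a refined structure 𝓕}, at ANY prime `p`, any reduction type, any number of auxiliary primes or order of «peeling» [cite: Jetchev2008, (1.3), Thm. 1.4, Cor. 1.5 (arXiv p. 3)] [cite: Buyukboduk2009TamagawaDefect, §4.2 Questions 1–2 (arXiv p. 12)]; in the W-ALL cell (`Summit.BirchSwinnertonDyer.WAll`, row 2·3@3) this is the located wall of route `route-BirchSwinnertonDyer-SemiOrdinaryEisensteinDescent` at crux J `WildSigmaDivisibilityAtThree` (stub `stub_beyondMax` of line `jetchev-max`) and crux Ko `WildKolyvaginUpperAtThree` (stub `stub_minftyGeManin` of line `birth` beyond the max), whose residue habitat (3 413 JET-PRODUCT classes,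 census T17) consists entirely of frames with ≥ 2 Tamagawa-`3` carriers; and the line idea «multi-prime stringent duality + iterated Čebotarev peeling» (cell memo TRANSFER-JETCHEV-AT3-v1 §4 L1 (iii)+(iv)) is void as a method
* because: if `n_v • 𝓖_v ≤ 𝓕_v` for all `v` and `n_v ∣ N`, then `N • H¹_𝓖 ≤ H¹_𝓕` (this file, `stringentKolyvaginCapsAtMax_holds`: localisation is additive); hence for ANY family `κ` satisfying the Kolyvagin relations for `𝓖` the family `N·κ` satisfies them together with ALL the refined local conditions, and its divisibility invariant is shifted by exactly `ord_p N` (no `p`-torsion in `E(K[n])`; Kolyvagin's redefinition of `m_∞`) — so a derivation «relations + 𝓕-membership ⟹ `m_∞ ≥ ord_p N + x`» yields «relations ⟹ `m_∞ ≥ x`» with the bad places absent: refined local conditions certify at most `ord_p N = max_v e_v`, the EXPONENT of `⊕_v 𝓖_v/𝓕_v`, while the BSD formula asks for its LENGTH `Σ_v e_v`; concretely, at a minimal core vertex `c` (Jetchev §6.2) `p^{max}⟨κ̃_c⟩ ≤ H¹_{𝓕_S(c)}^{ε} ≤ ⟨κ̃_c⟩` (Jetchev's own footnote «`m − m′ ≤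 m_max`») and the fully known dual side `Inv H¹_{𝓕_S(c)*}^{−ε} = (ord_p c_{q_1}, …, ord_p c_{q_s})` (Poitou–Tate) is restored after every peeling step, so nothing accumulates; where the module of Kolyvagin systems is free of rank one this is the identity `KS(𝓕_S) = p^{max}·KS(𝓖)` (⊇ by the theorem, ⊆ by the core-rank drop); kernel companions in the tree (cell `bsd-wall`, seat utd-p3 g4, p579463, `Theorems/SemiOrdinaryEisensteinDescentWildSigmaDivisibilityAtThreeStringencyCap.lean`): `Summit.BirchSwinnertonDyer.BirchSwinnertonDyer.Theorems.StringencyCap.nsmul_mem_selmerGroup_of_forall_nsmul_mem` (this inclusion), `relIndex_selmerGroup_dvd_pow_max` and `not_pow_add_dvd_relIndex_selmerGroup` (on a CYCLIC Selmer module — the rank-one stalk at a core vertex — two stringencies `p^{n₁}`, `p^{n₂}` cost index `∣ p^{max(n₁,n₂)}` and NOT `p^{n₁+n₂}` once `n₁, n₂ ≥ 1`: they overlap instead of stacking) [cite: Jetchev2008, Thm. 6.3 with footnote (arXiv p. 15)] [cite: Buyukboduk2009TamagawaDefect, Cor. 2.8 and Thm. 3.1 (arXiv pp. 10–11)] [cite: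 MazurRubinMemoirs2004, Thm. 5.2.10 and Prop. 6.2.6]
* evasions_known: (i) IWASAWA-MAIN-IDENTITY (IMC) / CONTROL inputs — the sum `Σ_v ord_p c_v` enters as the LENGTH of the Tamagawa error term of an anticyclotomic control theorem combined with an anticyclotomic IMC and an explicit reciprocity law: Burungale–Castella–Grossi–Skinner Thm. 2 (`𝓜_∞ = Σ ord_p c_ℓ`, good ordinary `p > 3`), C.-H. Kim's Cor. 7.8 (Heegner-point main identity ⟺ primitivity up to exactly the `N⁺`-Tamagawa sum) [cite: BurungaleEtAl2026, Thm. 2] [cite: Kim2022HigherGZ, Cor. 7.8]; (ii) CHANGING THE DATUM — for Heegner points on a Shimura curve `X_{N⁺,N⁻}` the Tamagawa numbers at `N⁻` are absorbed by the parametrisation and do not obstruct (Kim Cor. 7.8 (3); W. Zhang 2014) [cite: WZhang2014, Thm. 1.1]; (iii) CONGRUENCES — level lowering at a Tamagawa prime `ℓ ≠ p` (`p ∣ c_ℓ` ⟺ `E[p]` finite at `ℓ`, Ribet), suggested by Büyükboduk §4.2 as the road to Question 2; no printed result captures more than one factor this way [cite: Buyukboduk2009TamagawaDefect, §4.2 (arXiv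 p. 12)]
* scope_caveats: (a) the Lean statement is the elementary inclusion `N • H¹_𝓖 ≤ H¹_𝓕`; the METHOD conclusion («no derivation from relations + membership separates max from Σ») is the half-page scaling argument of the cell memo, on paper, and presupposes that the argument under audit uses the classes only through the Kolyvagin relations, Čebotarev, Poitou–Tate and 𝓕-membership — true of Jetchev §§4–6 and of Büyükboduk §§2–3 as printed, to be RE-CHECKED for any future argument claiming more; (b) it says nothing against the TRUTH of the Σ-form (proved at good ordinary `p > 3` by evasion (i)), nor against proofs that use the modular/analytic origin of the classes; (c) the identity `KS(𝓕_S) = p^{max}·KS(𝓖)` as an identity of free rank-one modules needs the Kolyvagin-system structure theory (Mazur–Rubin hypotheses H.0–H.6, `p > 4` for `T_pE`; Howard 2004 over `K` with `p ∤ N·d_K`) and is NOT claimed at `p = 3 ∣ N`; the derivation form needs none of it, and its cap is EXACTLY the max unconditionally: Jetchev's divided classes `κ̃_{c,m} = ι_{m_∞}⁻¹(κ_{c,m+m_∞})` (§3.1.7 with the uniform shift `m_∞`; needs only `E(K_c)[p] = 0`) form a derived family on `Λ_{m+m_∞}` satisfying the same relations with `m_∞(κ̃) = 0`, so a carrier-blind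 lower bound `x` on `m_∞` over all such families is `0` (observation of seat bsd-wall-soed-p2-w2 g0, cell STATUS 2026-08-27T22:30:41Z); (d) local conditions at places `v ∣ p` of infinite exponent (e.g. the Kummer condition itself at an additive `v ∣ p`) are not «bounded refinements» and are outside the statement — but no Euler system is known to satisfy a condition there finer than a bounded one (at additive `v ∣ 3`, Kodaira IV/IV*, the stringent quotient is `ℤ/3`, multiplier `3`); (e) `K`, `M` any number field / discrete module in the Lean statement (intended: `K` imaginary quadratic or `ℚ`, `M = E[p^m]`)
* status: established (theorem `stringentKolyvaginCapsAtMax_holds`; kernel companions p579463 `…Theorems.StringencyCap.*` incl. the two-carrier non-stacking `not_pow_add_dvd_relIndex_selmerGroup`; the printed one-prime optimality remarks [cite: Jetchev2008, Cor. 1.5] [cite: Buyukboduk2009TamagawaDefect, p. 2 («escapes our method») and §4.2]; texts read at the page by seat bsd-wall-soed-p2-w3 g0, 2026-08-27, memo NOGO-STRINGENT-SCALING-w3 = evidence #10 on stmt-BirchSwinnertonDyer-20480; amended the same day by the same seat with the kernel companions and caveat (c)'s unconditional exact cap — no Lean statement changed)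

[cite: Jetchev2008, Thm. 1.4, Cor. 1.5 (arXiv:math/0703431 p. 3) and Thm. 6.3 footnote (p. 15)]
[cite: Buyukboduk2009TamagawaDefect, Thm. 3.1, Cor. 3.3 (arXiv:0710.3858 pp. 10–11) and §4.2 Questions 1–2 (p. 12)] -/
def StringentKolyvaginCapsAtMax : Prop :=
  ∀ (K : Type u) [Field K] [NumberField K] (M : Type u) [AddCommGroup M] [TopologicalSpace M]
    [DiscreteTopology M] (ρ : DiscreteGaloisModule K M) (𝓕 𝓖 : SelmerStructure ρ) (n : Place K → ℕ) (N : ℕ),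
    IsBoundedRefinementBy 𝓕 𝓖 n → (∀ v : Place K, n v ∣ N) →
    ∀ c ∈ 𝓖.selmerGroup, N • c ∈ 𝓕.selmerGroup

/-- The barrier holds: localisation is additive, so `loc_v (N • c) = (N/n_v) • (n_v • loc_v c) ∈ 𝓕_v`.
[cite: Jetchev2008, Thm. 6.3 footnote «m − m′ ≤ m_max» (arXiv:math/0703431 p. 15)] -/
theorem stringentKolyvaginCapsAtMax_holds : StringentKolyvaginCapsAtMax.{u} := by
  intro K _ _ M _ _ _ ρ 𝓕 𝓖 n N hn hN c hc
  rw [SelmerStructure.mem_selmerGroup_iff] at hc ⊢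
  intro v
  obtain ⟨k, hk⟩ := hN v
  rw [map_nsmul, hk, mul_nsmul]
  exact AddSubgroup.nsmul_mem _ (hn v _ (hc v)) k

/-- `StringentKolyvaginCapsAtMax` — `_holds` alias of `stringentKolyvaginCapsAtMax_holds` above under the fact's exact name (appended
2026-08-28, D-0026 bookkeeping: the proof term is the existing theorem of this file; no statement,
definition or attribute is edited; no new named fact; the ledger's debt table listed the fact
unproved). [cite: Jetchev2008, Thm. 6.3 footnote «m − m′ ≤ m_max» (arXiv:math/0703431 p. 15)] -/
theorem _root_.Literature.Barriers.BirchSwinnertonDyer.StringentKolyvaginCapsAtMax_holds :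
    StringentKolyvaginCapsAtMax.{u} :=
  _root_.Literature.Barriers.BirchSwinnertonDyer.stringentKolyvaginCapsAtMax_holds

/-- **Reading for one refined place** (the shape of Jetchev's Thm. 6.3 / Büyükboduk's Thm. 3.1): if `𝓕` and `𝓖`
agree away from a set `S` of places and `p^{e_v} • 𝓖_v ≤ 𝓕_v` on `S` with `e_v ≤ e` there, then
`p^e • H¹_𝓖 ≤ H¹_𝓕` — the multiplier that makes every `𝓖`-class `𝓕`-stringent at ALL of `S` simultaneously is
`p^{max e_v}`, not `p^{Σ e_v}`. [cite: Jetchev2008, Def. 4.8 and Thm. 6.3 (arXiv:math/0703431 pp. 13, 15)]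
[cite: Buyukboduk2009TamagawaDefect, §4.2 Question 2 (arXiv:0710.3858 p. 12)] -/
theorem pow_nsmul_mem_selmerGroup_of_forall_le {ρ : DiscreteGaloisModule K M} (𝓕 𝓖 : SelmerStructure ρ)
    (S : Set (Place K)) (p e : ℕ) (eS : Place K → ℕ)
    (hoff : ∀ v ∉ S, 𝓖 v ≤ 𝓕 v) (hon : ∀ v ∈ S, ∀ x ∈ 𝓖 v, p ^ eS v • x ∈ 𝓕 v)
    (hle : ∀ v ∈ S, eS v ≤ e) {c : galoisCohomology ρ 1} (hc : c ∈ 𝓖.selmerGroup) :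
    p ^ e • c ∈ 𝓕.selmerGroup := by
  classical
  refine stringentKolyvaginCapsAtMax_holds K M ρ 𝓕 𝓖 (fun v ↦ if v ∈ S then p ^ eS v else 1) (p ^ e)
    ?_ ?_ c hc
  · intro v x hx
    by_cases hv : v ∈ S
    · simpa [hv] using hon v hv x hx
    · simpa [hv] using hoff v hv hx
  · intro v
    by_cases hv : v ∈ S
    · simpa [hv] using pow_dvd_pow p (hle v hv)
    · simp [hv]

end Literature.Barriers.BirchSwinnertonDyer
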